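import Literature.Topology.FourManifolds.SmaleHomologySpheresUniverse
import Literature.Topology.FourManifolds.HomotopySpheresInverseDischarge
import Literature.Topology.FourManifolds.RotationBodyRetract
import Literature.Topology.FourManifolds.CorkDecompositionSplittingProof
import Literature.Topology.FourManifolds.ConnectedSumProofs
import Literature.Topology.FourManifolds.SchoenfliesFlat
import HarnessLib

/-!
# Milnor's Prop. B from the h-cobordism theorem ALONE: the double `M # (-M)` and Brown's Schoenflies theorem

Topic `Literature/Topology/FourManifolds`, sibling proofs file of `SmaleHomologySpheres.lean` (fact
seat of `Literature.Topology.FourManifolds.nonempty_homeomorph_sphere_of_homologySphere_of_five_le`,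
Milnor, *Lectures on the h-cobordism theorem* (1965), §9, Prop. B, first sentence: *a closed simply
connected smooth `n`-manifold, `n ≥ 5`, with the integral homology of `Sⁿ` is homeomorphic to
`Sⁿ`*), continuing `SmaleHomologySpheresHCobordism.lean` and `SmaleHomologySpheresUniverse.lean`.

Those files prove Prop. B from three hubs of the tree: the h-cobordism theorem (Milnor Thm. 9.1,
`isTrivial_of_isHCobordism_of_five_le`), the homotopy half of Kervaire–Milnor's Lemma 2.3
(`NullCobordism.isHomotopyEquiv_compl_ball_of_contractibleSpace`, now a THEOREM of the tree,
`HomotopySpheresInverseDischarge.lean`) and — for `n = 5` only, where Milnor's printed proof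
quotes Kervaire–Milnor and Wall ("`M⁵` bounds a contractible `W⁶`", i.e. `Θ₅ = 0`) — the named
fact `Milnor1965_boundsContractible_of_homologySphere`, a theory (Pontryagin–Thom, `π₅ˢ`, framed
surgery) absent from the tree.

This file removes that last hub from the homeomorphism statement.  For a closed simply connected
smooth homology `n`-sphere `M`, `n ≥ 5` (all `n` at once, no case split):

1. **The double bounds a contractible manifold** (Kervaire–Milnor, *Groups of homotopy spheres I*
   (1963), Lemma 2.4 and its proof, p. 507, which uses only that `M ∖ {pt}` is contractible): the
   double `P₀ = M # (-M)` formed with one disc `i` (tree: `RotationData.P₀`, the glued manifold of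
   the connected sum data `(e, e)`) bounds Kervaire–Milnor's rotation body `W`
   (`RotationData.nullCobordism`, `RotationBodyBoundary.lean`), and `W ≃ₕ M ∖ {i 0}`
   (`RotationData.homotopyEquivPunct`, `RotationBodyRetract.lean`) is contractible because a
   punctured simply connected homology sphere is (general position, Mayer–Vietoris, and the
   Whitehead–Hurewicz recognition theorem `Manifold.contractibleSpace_of_simplyConnected_of_acyclic_holds`).
   `P₀` is simply connected (Seifert–van Kampen, `IsConnectedSum.simplyConnectedSpace_holds`).
2. **Hence `P₀ ≅ Sⁿ`** by the route of Milnor's Prop. A already formalised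
   (`SmaleHomologySpheres.nonempty_homeomorph_sphere_of_boundsContractible`: Thm. 9.1 on
   `W ∖ (disc)`, Lemma 2.3, cone filling), GIVEN Thm. 9.1.
3. **Brown's generalized Schoenflies theorem** (M. Brown 1960; Daverman, *Decompositions of
   manifolds* (1986), Thm. II.6.6 — PROVED in the tree, `SchoenfliesBrown.lean`/`SchoenfliesFlat.lean`):
   the neck `i(S_{1/2}ⁿ⁻¹)` of the double is bicollared in the topological sphere `P₀`, with far
   sides the two copies of `M ∖ i(B_{3/4})`; so its closed side `M ∖ i(B̊_{1/2}) ⊂ P₀` is an `n`-cell,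
   as a pair (`IsBicollarSides.nonempty_homeomorph_left`, `IsBicollarSides.norm_eq_one_iff_left`).
4. **The Alexander trick** (Milnor's "every twisted sphere is homeomorphic to `Sⁿ`", §9 p. 110,
   tree theorem `SmaleHomologySpheres.nonempty_homeomorph_sphere_of_homeomorph_compl_ball`):
   `M = i(B̄_{1/2}) ∪ (M ∖ i(B̊_{1/2})) ≅ Sⁿ`.

Results (all PROVED, no named fact introduced, nothing of the fact files modified):

* `SmaleHomologySpheres.isBicollarSides_double`, `SmaleHomologySpheres.nonempty_homeomorph_sphere_of_double`
  — steps 3–4 for an abstract double: `M` compact Hausdorff with an open disc `i : ℝⁿ → M`, a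
  compact metric topological `n`-sphere `S` covered by two continuous copies `jA, jB` of
  `M ∖ {i 0}` identified exactly along Kervaire–Milnor's relation `connectedSumRel i i`; then
  `M ≅ Sⁿ`.
* `SmaleHomologySpheres.boundsContractible_double` — step 1;
  `SmaleHomologySpheres.nonempty_homeomorph_sphere_of_homologySphere_of_double` — steps 1–4:
  Prop. B at universe `0` for `n = m + 1 ≥ 5` GIVEN ONLY `isTrivial_of_isHCobordism_of_five_le.{0}`.
* `nonempty_homeomorph_sphere_of_homologySphere_of_five_le_of_hcobordism_theorem` — **the named
  fact at every universe from Thm. 9.1 alone** (universe transport of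
  `SmaleHomologySpheresUniverse.lean`).  The discharge `…_holds` is this theorem applied to
  `isTrivial_of_isHCobordism_of_five_le_holds` once the h-cobordism seats land it.

## References

* J. Milnor, *Lectures on the h-cobordism theorem*, Princeton Mathematical Notes (1965), §9,
  Prop. A, Prop. B and their proofs (pp. 108–111; held copy PDF pp. 57–59). [MilnorHCobordism1965]
* M. Kervaire, J. Milnor, *Groups of homotopy spheres I*, Ann. of Math. (2) 77 (1963), 504–537:
  §2 (connected sum, p. 505), Lemma 2.3 (p. 506), Lemma 2.4 and its proof (p. 507).
  [KervaireMilnorAnnals1963]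
* M. Brown, *A proof of the generalized Schoenflies theorem*, Bull. Amer. Math. Soc. 66 (1960)
  74–76. [Brown1960]
* R. J. Daverman, *Decompositions of manifolds*, Academic Press (1986), §II.6 Thm. 6. [Daverman1986]
-/

noncomputable section

open scoped Manifold ContDiff Topology
open Set Function Metric Topology CategoryTheory.Limits
open Literature.AlgebraicTopology.SingularHomology

universe u v

namespace Literature.Topology.FourManifolds

/-- Local notation: `𝔼 n` is the model Euclidean space `EuclideanSpace ℝ (Fin n)`. -/
local notation "𝔼 " n:arg => EuclideanSpace ℝ (Fin n)

/-- Local notation: `𝕊 n` is the unit sphere in `EuclideanSpace ℝ (Fin (n + 1))`. -/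
local notation "𝕊 " n:arg => (Metric.sphere (0 : EuclideanSpace ℝ (Fin (n + 1))) 1)

namespace SmaleHomologySpheres

/-! ### §1 The neck of a double: collar, far sides, and Brown's theorem -/

section Double

variable {n : ℕ} {M : Type u} [TopologicalSpace M] [T2Space M] {i : 𝔼 n → M}

/-- The radius `ρ(s) = (2 + s)/4 ∈ [¼, ¾]` at height `s ∈ [-1, 1]` of the collar of the neck.
[folklore] -/
def collarRadius (s : ℝ) : ℝ := (2 + s) / 4

/-- `ρ` is continuous. [folklore] -/
theorem continuous_collarRadius : Continuous collarRadius := by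
  unfold collarRadius; fun_prop

/-- `ρ(s) ∈ [¼, ¾]` for `s ∈ [-1, 1]`. [folklore] -/
theorem collarRadius_mem {s : ℝ} (hs : s ∈ Icc (-1 : ℝ) 1) :
    4⁻¹ ≤ collarRadius s ∧ collarRadius s ≤ 3 / 4 := by
  obtain ⟨h1, h2⟩ := hs
  unfold collarRadius
  constructor <;> linarith

/-- `ρ(s) > 0` on `[-1, 1]`. [folklore] -/
theorem collarRadius_pos {s : ℝ} (hs : s ∈ Icc (-1 : ℝ) 1) : 0 < collarRadius s := by
  have := (collarRadius_mem hs).1; linarith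

/-- `ρ(s) < 1` on `[-1, 1]`. [folklore] -/
theorem collarRadius_lt_one {s : ℝ} (hs : s ∈ Icc (-1 : ℝ) 1) : collarRadius s < 1 := by
  have := (collarRadius_mem hs).2; linarith

/-- `ρ(4r - 2) = r`. [folklore] -/
theorem collarRadius_sub (r : ℝ) : collarRadius (4 * r - 2) = r := by
  unfold collarRadius; ring

/-- `ρ` is injective. [folklore] -/
theorem collarRadius_injective : Injective collarRadius := fun s t h => by
  unfold collarRadius at h; linarith

omit [TopologicalSpace M] [T2Space M] in
/-- The image of the ball of radius `r` under an injective disc, read on the disc. [folklore] -/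
theorem apply_mem_image_ball_iff (hi : Injective i) {v : 𝔼 n} {r : ℝ} :
    i v ∈ i '' ball (0 : 𝔼 n) r ↔ ‖v‖ < r := by
  rw [hi.mem_set_image, mem_ball_zero_iff]

/-- A point `i w` with `w ≠ 0` lies in the punctured manifold `M ∖ {i 0}`. [folklore] -/
theorem apply_mem_puncture (hi : Injective i) {w : 𝔼 n} (hw : w ≠ 0) : i w ∈ puncture i := by
  change i w ∈ ({i 0}ᶜ : Set M)
  rw [mem_compl_singleton_iff, hi.ne_iff]
  exact hw

/-- **The collar of the neck, in `M`**: `(u, s) ↦ i(ρ(s) u)`, a point of `M ∖ {i 0}`.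
[cite: Daverman1986, proof of Thm. II.6.6 (PDF p. 40)] -/
def collarPt (hi : Injective i) (p : ↥(sphere (0 : 𝔼 n) 1) × ↥(Icc (-1 : ℝ) 1)) : ↥(puncture i) :=
  ⟨i (collarRadius p.2 • (p.1 : 𝔼 n)),
    apply_mem_puncture hi (smul_ne_zero (collarRadius_pos p.2.2).ne' (ne_zero_of_mem_unit_sphere p.1))⟩

/-- The collar point in `M`. [folklore] -/
@[simp] theorem coe_collarPt (hi : Injective i) (p : ↥(sphere (0 : 𝔼 n) 1) × ↥(Icc (-1 : ℝ) 1)) :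
    (collarPt hi p : M) = i (collarRadius p.2 • (p.1 : 𝔼 n)) := rfl

/-- The disc coordinate of a collar point has norm `ρ(s)`. [folklore] -/
theorem norm_collar (p : ↥(sphere (0 : 𝔼 n) 1) × ↥(Icc (-1 : ℝ) 1)) :
    ‖collarRadius p.2 • (p.1 : 𝔼 n)‖ = collarRadius p.2 := by
  rw [norm_smul, Real.norm_eq_abs, abs_of_pos (collarRadius_pos p.2.2), norm_eq_of_mem_sphere, mul_one]

/-- The collar in `M` is continuous. [folklore] -/
theorem continuous_collarPt (hi : Injective i) (hic : Continuous i) : Continuous (collarPt hi) := by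
  refine Continuous.subtype_mk (hic.comp ?_) _
  exact ((continuous_collarRadius.comp (continuous_subtype_val.comp continuous_snd)).smul
    (continuous_subtype_val.comp continuous_fst))

/-- The collar in `M` is injective. [folklore] -/
theorem collarPt_injective (hi : Injective i) : Injective (collarPt hi) := by
  rintro ⟨u, s⟩ ⟨u', s'⟩ h
  have h1 : collarRadius s • (u : 𝔼 n) = collarRadius s' • (u' : 𝔼 n) := hi (congrArg Subtype.val h)
  have h2 : collarRadius (s : ℝ) = collarRadius s' := by
    have h' := congrArg norm h1
    rwa [norm_collar (u, s), norm_collar (u', s')] at h'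
  have hs : s = s' := Subtype.ext (collarRadius_injective h2)
  subst hs
  have hu : (u : 𝔼 n) = u' := smul_right_injective (𝔼 n) (collarRadius_pos s.2).ne' h1
  rw [Subtype.ext hu]

/-- A point of `M ∖ {i 0}` inside `i(B_r)` is `i(t u)` with `‖u‖ = 1`, `0 < t < r`. [folklore] -/
theorem exists_eq_apply_smul (a : ↥(puncture i)) {r : ℝ}
    (ha : (a : M) ∈ i '' ball (0 : 𝔼 n) r) :
    ∃ (u : 𝔼 n) (t : ℝ), ‖u‖ = 1 ∧ 0 < t ∧ t < r ∧ (a : M) = i (t • u) := by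
  obtain ⟨v, hv, hva⟩ := ha
  rw [mem_ball_zero_iff] at hv
  have hv0 : v ≠ 0 := by
    rintro rfl
    exact a.2 hva.symm
  have hvn : 0 < ‖v‖ := norm_pos_iff.2 hv0
  refine ⟨‖v‖⁻¹ • v, ‖v‖, ?_, hvn, hv, ?_⟩
  · rw [norm_smul, norm_inv, norm_norm, inv_mul_cancel₀ hvn.ne']
  · rw [smul_inv_smul₀ hvn.ne', hva]

variable {S : Type v} [TopologicalSpace S]

/-- **A far side of the neck**: the copy `j(M ∖ i(B̊_r))` in the double. [cite: Daverman1986, proof of Thm. II.6.6 (PDF p. 40)] -/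
def farSide (i : 𝔼 n → M) (j : ↥(puncture i) → S) (r : ℝ) : Set S :=
  j '' {a | (a : M) ∉ i '' ball (0 : 𝔼 n) r}

/-- **The collar of the neck in the double**: `(u, s) ↦ jA(i(ρ(s) u))`. [cite: Daverman1986, proof of Thm. II.6.6 (PDF p. 40)] -/
def collar (hi : Injective i) (jA : ↥(puncture i) → S) :
    ↥(sphere (0 : 𝔼 n) 1) × ↥(Icc (-1 : ℝ) 1) → S :=
  jA ∘ collarPt hi

variable {jA jB : ↥(puncture i) → S}

omit [TopologicalSpace S] in
/-- A collar point lies in the far side of radius `r` of its own copy iff `r ≤ ρ(s)`. [folklore] -/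
theorem collar_mem_farSide_iff (hi : Injective i) (hj : Injective jA) {r : ℝ}
    (p : ↥(sphere (0 : 𝔼 n) 1) × ↥(Icc (-1 : ℝ) 1)) :
    collar hi jA p ∈ farSide i jA r ↔ r ≤ collarRadius p.2 := by
  rw [farSide, collar, comp_apply, hj.mem_set_image, mem_setOf_eq, coe_collarPt,
    apply_mem_image_ball_iff hi, norm_collar, not_lt]

omit [TopologicalSpace S] in
/-- **The collar read in the other copy**: under Kervaire–Milnor's identification
`i(tu) ∼ i((1 - t)u)`, the collar point at height `s` is the point `i((1 - ρ(s)) u)` of the second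
copy. [cite: KervaireMilnorAnnals1963, §2 (p. 505)] -/
theorem collar_eq_iff (hi : Injective i) (glue : ∀ a b, jA a = jB b ↔ connectedSumRel i i a b)
    (p : ↥(sphere (0 : 𝔼 n) 1) × ↥(Icc (-1 : ℝ) 1)) (b : ↥(puncture i)) :
    collar hi jA p = jB b ↔ (b : M) = i ((1 - collarRadius p.2) • (p.1 : 𝔼 n)) := by
  rw [collar, comp_apply, glue]
  constructor
  · rintro ⟨u, t, hu, ht, ha, hb⟩
    rw [coe_collarPt] at ha
    have ha' := hi ha
    have ht' : collarRadius (p.2 : ℝ) = t := by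
      have h' := congrArg norm ha'
      rwa [norm_collar, norm_smul, Real.norm_eq_abs, abs_of_pos ht.1, hu, mul_one] at h'
    subst ht'
    have hu' : (p.1 : 𝔼 n) = u := smul_right_injective (𝔼 n) (collarRadius_pos p.2.2).ne' ha'
    rw [hb, hu']
  · intro hb
    exact ⟨p.1, collarRadius p.2, norm_eq_of_mem_sphere p.1,
      ⟨collarRadius_pos p.2.2, collarRadius_lt_one p.2.2⟩, rfl, hb⟩

/-- The far pieces `M ∖ i(B̊_r)`, `r > 0`, of the punctured manifold are compact (`M` compact, `i`
open). [folklore] -/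
theorem isCompact_far [CompactSpace M] (hi : IsOpenEmbedding i) {r : ℝ} (hr : 0 < r) :
    IsCompact {a : ↥(puncture i) | (a : M) ∉ i '' ball (0 : 𝔼 n) r} := by
  rw [IsEmbedding.subtypeVal.isCompact_iff]
  have hset : Subtype.val '' {a : ↥(puncture i) | (a : M) ∉ i '' ball (0 : 𝔼 n) r} =
      (i '' ball (0 : 𝔼 n) r)ᶜ := by
    ext y
    constructor
    · rintro ⟨a, ha, rfl⟩
      exact ha
    · intro hy
      refine ⟨⟨y, ?_⟩, hy, rfl⟩
      change y ∈ ({i 0}ᶜ : Set M)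
      rw [mem_compl_singleton_iff]
      rintro rfl
      exact hy ⟨0, mem_ball_self hr, rfl⟩
  rw [hset]
  exact ((hi.isOpenMap _ isOpen_ball).isClosed_compl).isCompact

omit [TopologicalSpace S] in
/-- Every point of the first copy lies in a far side or in the collar. [folklore] -/
theorem apply_mem_union (hi : Injective i) (glue : ∀ a b, jA a = jB b ↔ connectedSumRel i i a b)
    (a : ↥(puncture i)) :
    jA a ∈ farSide i jA (3 / 4) ∪ farSide i jB (3 / 4) ∪ range (collar hi jA) := by
  by_cases ha : (a : M) ∈ i '' ball (0 : 𝔼 n) (3 / 4)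
  · obtain ⟨u, t, hu, ht0, ht, hat⟩ := exists_eq_apply_smul a ha
    have hu0 : u ≠ 0 := fun h => by rw [h, norm_zero] at hu; exact zero_ne_one hu
    by_cases hq : 4⁻¹ ≤ t
    · -- in the collar, at height `4t - 2`
      right
      refine ⟨(⟨u, mem_sphere_zero_iff_norm.2 hu⟩, ⟨4 * t - 2, by constructor <;> linarith⟩), ?_⟩
      show jA (collarPt hi _) = jA a
      congr 1
      apply Subtype.ext
      rw [coe_collarPt, hat]
      show i (collarRadius (4 * t - 2) • u) = i (t • u)
      rw [collarRadius_sub]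
    · -- in the far side of the second copy
      left; right
      refine ⟨⟨i ((1 - t) • u), apply_mem_puncture hi (smul_ne_zero (by linarith) hu0)⟩, ?_, ?_⟩
      · show i ((1 - t) • u) ∉ i '' ball (0 : 𝔼 n) (3 / 4)
        rw [apply_mem_image_ball_iff hi, norm_smul, Real.norm_eq_abs, abs_of_pos (by linarith), hu,
          mul_one, not_lt]
        linarith [not_le.1 hq]
      · symm
        exact (glue a _).2 ⟨u, t, hu, ⟨ht0, by linarith⟩, hat, rfl⟩
  · left; left
    exact ⟨a, ha, rfl⟩

/-- **The neck of a double is a bicollared sphere with the two far copies as its sides.** Let `M`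
be compact Hausdorff with an open disc `i : ℝⁿ → M`, and let the Hausdorff space `S` be covered by
two continuous copies `jA`, `jB` of `M ∖ {i 0}` (`jA` injective) identified exactly along
Kervaire–Milnor's relation `i(tu) ∼ i((1 - t)u)` (`0 < t < 1`). Then the collar
`(u, s) ↦ jA(i(ρ(s)u))`, `ρ(s) = (2 + s)/4`, together with `A = jA(M ∖ i(B̊_{3/4}))` and
`B = jB(M ∖ i(B̊_{3/4}))`, is a bicollared sphere with sides in the sense of the tree's
`IsBicollarSides` (Daverman's `A`, `B`, `Σ = h(Sⁿ⁻¹ × 0) = jA(i(S_{1/2}))`).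
[cite: Daverman1986, proof of Thm. II.6.6 (PDF p. 40)] [cite: KervaireMilnorAnnals1963, §2 (p. 505)] -/
theorem isBicollarSides_double [T2Space S] [CompactSpace M] (hi : IsOpenEmbedding i)
    (hjA : Continuous jA) (hjAi : Injective jA) (hjB : Continuous jB)
    (cover : ∀ x : S, (∃ a, jA a = x) ∨ ∃ b, jB b = x)
    (glue : ∀ a b, jA a = jB b ↔ connectedSumRel i i a b) :
    IsBicollarSides (collar hi.injective jA) (farSide i jA (3 / 4)) (farSide i jB (3 / 4)) where
  continuous := hjA.comp (continuous_collarPt hi.injective hi.continuous)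
  injective := hjAi.comp (collarPt_injective hi.injective)
  isClosed_left := ((isCompact_far hi (by norm_num : (0 : ℝ) < 3 / 4)).image hjA).isClosed
  isClosed_right := ((isCompact_far hi (by norm_num : (0 : ℝ) < 3 / 4)).image hjB).isClosed
  disjoint := by
    refine disjoint_left.2 ?_
    rintro x ⟨a, ha, rfl⟩ ⟨b, hb, hab⟩
    obtain ⟨u, t, hu, ht, hau, hbu⟩ := (glue a b).1 hab.symm
    have h1 : ¬ ‖t • u‖ < 3 / 4 := by
      rw [← apply_mem_image_ball_iff hi.injective, ← hau]; exact ha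
    have h2 : ¬ ‖(1 - t) • u‖ < 3 / 4 := by
      rw [← apply_mem_image_ball_iff hi.injective, ← hbu]; exact hb
    rw [norm_smul, Real.norm_eq_abs, abs_of_pos ht.1, hu, mul_one] at h1
    rw [norm_smul, Real.norm_eq_abs, abs_of_pos (by linarith [ht.2] : (0 : ℝ) < 1 - t), hu,
      mul_one] at h2
    linarith [not_lt.1 h1, not_lt.1 h2]
  left_inter_range := by
    ext x
    constructor
    · rintro ⟨hxA, p, rfl⟩
      have hp : (3 / 4 : ℝ) ≤ collarRadius p.2 :=
        (collar_mem_farSide_iff hi.injective hjAi p).1 hxA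
      refine ⟨p, ?_, rfl⟩
      show (p.2 : ℝ) = 1
      have h2 := p.2.2.2
      unfold collarRadius at hp
      linarith
    · rintro ⟨p, hp, rfl⟩
      refine ⟨(collar_mem_farSide_iff hi.injective hjAi p).2 ?_, mem_range_self p⟩
      have hp' : (p.2 : ℝ) = 1 := hp
      rw [hp']
      norm_num [collarRadius]
  right_inter_range := by
    ext x
    constructor
    · rintro ⟨⟨b, hb, hbx⟩, p, rfl⟩
      have hb' := (collar_eq_iff hi.injective glue p b).1 hbx.symm
      have h3 : ¬ ‖(1 - collarRadius (p.2 : ℝ)) • (p.1 : 𝔼 n)‖ < 3 / 4 := by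
        rw [← apply_mem_image_ball_iff hi.injective, ← hb']; exact hb
      rw [norm_smul, Real.norm_eq_abs, abs_of_pos (by linarith [collarRadius_lt_one p.2.2]),
        norm_eq_of_mem_sphere, mul_one, not_lt] at h3
      refine ⟨p, ?_, rfl⟩
      show (p.2 : ℝ) = -1
      have h1 := p.2.2.1
      unfold collarRadius at h3
      linarith
    · rintro ⟨p, hp, rfl⟩
      refine ⟨?_, mem_range_self p⟩
      have hp' : (p.2 : ℝ) = -1 := hp
      have hne : (1 - collarRadius (p.2 : ℝ)) • (p.1 : 𝔼 n) ≠ 0 :=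
        smul_ne_zero (by linarith [collarRadius_lt_one p.2.2]) (ne_zero_of_mem_unit_sphere p.1)
      refine ⟨⟨i ((1 - collarRadius (p.2 : ℝ)) • (p.1 : 𝔼 n)), apply_mem_puncture hi.injective hne⟩,
        ?_, ((collar_eq_iff hi.injective glue p _).2 rfl).symm⟩
      show i ((1 - collarRadius (p.2 : ℝ)) • (p.1 : 𝔼 n)) ∉ i '' ball (0 : 𝔼 n) (3 / 4)
      rw [apply_mem_image_ball_iff hi.injective, norm_smul, Real.norm_eq_abs,
        abs_of_pos (by linarith [collarRadius_lt_one p.2.2]), norm_eq_of_mem_sphere, mul_one, hp']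
      norm_num [collarRadius]
  union_eq_univ := by
    refine eq_univ_of_forall fun x => ?_
    rcases cover x with ⟨a, rfl⟩ | ⟨b, rfl⟩
    · exact apply_mem_union hi.injective glue a
    · by_cases hb : (b : M) ∈ i '' ball (0 : 𝔼 n) (3 / 4)
      · obtain ⟨u, t, hu, ht0, ht, hbt⟩ := exists_eq_apply_smul b hb
        have hu0 : u ≠ 0 := fun h => by rw [h, norm_zero] at hu; exact zero_ne_one hu
        -- the same point seen from the first copy: `i((1 - t) u)`
        have hab : jA ⟨i ((1 - t) • u), apply_mem_puncture hi.injective (smul_ne_zero (by linarith) hu0)⟩ =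
            jB b :=
          (glue _ b).2 ⟨u, 1 - t, hu, ⟨by linarith, by linarith⟩, rfl, by rw [sub_sub_cancel]; exact hbt⟩
        rw [← hab]
        exact apply_mem_union hi.injective glue _
      · left; right
        exact ⟨b, hb, rfl⟩

/-- **The half disc** `i₂(v) = i(v/2)`: `i₂(B̊) = i(B̊_{1/2})`, `i₂(Sⁿ⁻¹) = i(S_{1/2}) = Σ`. [folklore] -/
def halfDisc (i : 𝔼 n → M) (v : 𝔼 n) : M := i ((2⁻¹ : ℝ) • v)

omit [T2Space M] in
/-- The half disc is an open embedding if the disc is. [folklore] -/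
theorem isOpenEmbedding_halfDisc (hi : IsOpenEmbedding i) : IsOpenEmbedding (halfDisc i) :=
  hi.comp (Homeomorph.smulOfNeZero (2⁻¹ : ℝ) (by norm_num)).isOpenEmbedding

omit [TopologicalSpace M] [T2Space M] in
/-- `i₂(B̊) = i(B̊_{1/2})`, pointwise. [folklore] -/
theorem mem_image_halfDisc_ball_iff (y : M) :
    y ∈ halfDisc i '' ball (0 : 𝔼 n) 1 ↔ y ∈ i '' ball (0 : 𝔼 n) 2⁻¹ := by
  constructor
  · rintro ⟨v, hv, rfl⟩
    refine ⟨(2⁻¹ : ℝ) • v, ?_, rfl⟩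
    rw [mem_ball_zero_iff] at hv ⊢
    rw [norm_smul, norm_inv, Real.norm_two]
    linarith
  · rintro ⟨w, hw, rfl⟩
    refine ⟨(2 : ℝ) • w, ?_, ?_⟩
    · rw [mem_ball_zero_iff] at hw ⊢
      rw [norm_smul, Real.norm_two]
      linarith
    · show i ((2⁻¹ : ℝ) • (2 : ℝ) • w) = i w
      rw [inv_smul_smul₀ two_ne_zero]

/-- **An abstract double which is a topological sphere forces `M ≅ Sⁿ`** (Brown's generalized
Schoenflies theorem plus the Alexander trick). Let `M` be compact Hausdorff with an open disc
`i : ℝⁿ → M`, `n ≥ 1`, and let the compact metric topological `n`-sphere `S` be covered by two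
continuous copies `jA, jB : M ∖ {i 0} → S` (`jA` injective) identified exactly along
Kervaire–Milnor's connected-sum relation (`jA a = jB b ↔ connectedSumRel i i a b`). Then `M` is
homeomorphic to `Sⁿ`: the neck is bicollared with sides (`isBicollarSides_double`), so its closed
side `jA(M ∖ i(B̊_{1/2}))` is an `n`-cell carrying `Σ = jA(i(S_{1/2}))` onto `∂B̄ⁿ` (Daverman
Thm. II.6.6, tree theorems `IsBicollarSides.nonempty_homeomorph_left`,
`IsBicollarSides.norm_eq_one_iff_left`); read in `M` through `jA` this is a homeomorphism
`M ∖ i₂(B̊) ≅ B̄ⁿ` seam-to-boundary for the half disc `i₂`, and Milnor's twisted-sphere map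
(`nonempty_homeomorph_sphere_of_homeomorph_compl_ball`) finishes.
[cite: Daverman1986, Thm. II.6.6 (PDF p. 40)] [cite: MilnorHCobordism1965, §9, proof of Prop. B (p. 110)] -/
theorem nonempty_homeomorph_sphere_of_double (hn : 0 < n) [CompactSpace M]
    (hi : IsOpenEmbedding i) {S : Type v} [MetricSpace S] [CompactSpace S] (hS : IsTopSphere n S)
    {jA jB : ↥(puncture i) → S} (hjA : Continuous jA) (hjAi : Injective jA) (hjB : Continuous jB)
    (cover : ∀ x : S, (∃ a, jA a = x) ∨ ∃ b, jB b = x)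
    (glue : ∀ a b, jA a = jB b ↔ connectedSumRel i i a b) :
    Nonempty (M ≃ₜ 𝕊 n) := by
  have H := isBicollarSides_double hi hjA hjAi hjB cover glue
  obtain ⟨ψ⟩ := H.nonempty_homeomorph_left hS hn
  have hinj := hi.injective
  -- points outside the half ball are points of the punctured manifold
  have key1 : ∀ y : M, y ∉ halfDisc i '' ball (0 : 𝔼 n) 1 → y ∈ puncture i := by
    intro y hy
    change y ∈ ({i 0}ᶜ : Set M)
    rw [mem_compl_singleton_iff]
    rintro rfl
    exact hy ⟨0, mem_ball_self one_pos, by simp [halfDisc]⟩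
  -- the closed side `D_A = A ∪ h(Sⁿ⁻¹ × [0, 1])` is `jA(M ∖ i(B̊_{1/2}))`
  have key2 : ∀ a : ↥(puncture i), (a : M) ∉ i '' ball (0 : 𝔼 n) 2⁻¹ →
      jA a ∈ farSide i jA (3 / 4) ∪ collar hinj jA '' {p | 0 ≤ (p.2 : ℝ)} := by
    intro a ha
    by_cases ha' : (a : M) ∈ i '' ball (0 : 𝔼 n) (3 / 4)
    · obtain ⟨u, t, hu, ht0, ht, hat⟩ := exists_eq_apply_smul a ha'
      have hq : (2⁻¹ : ℝ) ≤ t := by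
        rw [hat, apply_mem_image_ball_iff hinj, norm_smul, Real.norm_eq_abs, abs_of_pos ht0, hu,
          mul_one, not_lt] at ha
        exact ha
      right
      refine ⟨(⟨u, mem_sphere_zero_iff_norm.2 hu⟩, ⟨4 * t - 2, by constructor <;> linarith⟩),
        (show (0 : ℝ) ≤ 4 * t - 2 by linarith), ?_⟩
      show jA (collarPt hinj _) = jA a
      congr 1
      apply Subtype.ext
      rw [coe_collarPt, hat]
      show i (collarRadius (4 * t - 2) • u) = i (t • u)
      rw [collarRadius_sub]
    · left
      exact ⟨a, ha', rfl⟩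
  have key3 : ∀ z ∈ farSide i jA (3 / 4) ∪ collar hinj jA '' {p | 0 ≤ (p.2 : ℝ)},
      ∃ a : ↥(puncture i), (a : M) ∉ i '' ball (0 : 𝔼 n) 2⁻¹ ∧ jA a = z := by
    rintro z (⟨a, ha, rfl⟩ | ⟨p, hp, rfl⟩)
    · exact ⟨a, fun h => ha (image_mono (ball_subset_ball (by norm_num)) h), rfl⟩
    · refine ⟨collarPt hinj p, ?_, rfl⟩
      have hp' : (0 : ℝ) ≤ p.2 := hp
      rw [coe_collarPt, apply_mem_image_ball_iff hinj, norm_collar, not_lt]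
      unfold collarRadius
      linarith
  -- the comparison map `M ∖ i₂(B̊) → D_A`, a continuous bijection of compacta
  let F : ↥((halfDisc i '' ball (0 : 𝔼 n) 1)ᶜ) →
      ↥(farSide i jA (3 / 4) ∪ collar hinj jA '' {p | 0 ≤ (p.2 : ℝ)}) := fun y =>
    ⟨jA ⟨y, key1 y y.2⟩, key2 _ (fun h => y.2 ((mem_image_halfDisc_ball_iff (y : M)).2 h))⟩
  have hFc : Continuous F :=
    (hjA.comp (Continuous.subtype_mk continuous_subtype_val _)).subtype_mk _
  have hFb : Bijective F := by
    constructor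
    · intro y y' h
      have h' : (⟨(y : M), key1 y y.2⟩ : ↥(puncture i)) = ⟨(y' : M), key1 y' y'.2⟩ :=
        hjAi (congrArg Subtype.val h)
      have h'' := Subtype.ext_iff.1 h'
      exact Subtype.ext h''
    · intro z
      obtain ⟨a, ha, haz⟩ := key3 z z.2
      refine ⟨⟨(a : M), fun h => ha ((mem_image_halfDisc_ball_iff (a : M)).1 h)⟩, Subtype.ext ?_⟩
      show jA ⟨(a : M), _⟩ = (z : S)
      rw [← haz]
  haveI : CompactSpace ↥((halfDisc i '' ball (0 : 𝔼 n) 1)ᶜ) :=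
    isCompact_iff_compactSpace.1
      (((isOpenEmbedding_halfDisc hi).isOpenMap _ isOpen_ball).isClosed_compl.isCompact)
  let φ₁ : ↥((halfDisc i '' ball (0 : 𝔼 n) 1)ᶜ) ≃ₜ
      ↥(farSide i jA (3 / 4) ∪ collar hinj jA '' {p | 0 ≤ (p.2 : ℝ)}) :=
    Continuous.homeoOfEquivCompactToT2 (f := Equiv.ofBijective F hFb) hFc
  refine nonempty_homeomorph_sphere_of_homeomorph_compl_ball (isOpenEmbedding_halfDisc hi)
    (φ₁.trans ψ) fun y => ?_
  rw [Homeomorph.trans_apply, mem_sphere_zero_iff_norm, H.norm_eq_one_iff_left hS ψ]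
  change jA ⟨(y : M), key1 y y.2⟩ ∈ collar hinj jA '' {p | (p.2 : ℝ) = 0} ↔
    (y : M) ∈ halfDisc i '' sphere (0 : 𝔼 n) 1
  constructor
  · rintro ⟨p, hp, hpy⟩
    have hval : (collarPt hinj p : M) = y := congrArg Subtype.val (hjAi hpy)
    have hp' : (p.2 : ℝ) = 0 := hp
    refine ⟨(p.1 : 𝔼 n), p.1.2, ?_⟩
    rw [← hval, coe_collarPt, hp']
    show i ((2⁻¹ : ℝ) • (p.1 : 𝔼 n)) = i (collarRadius 0 • (p.1 : 𝔼 n))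
    norm_num [collarRadius]
  · rintro ⟨u, hu, huy⟩
    refine ⟨(⟨u, hu⟩, ⟨0, by norm_num⟩), rfl, ?_⟩
    show jA (collarPt hinj _) = jA ⟨(y : M), _⟩
    congr 1
    apply Subtype.ext
    rw [coe_collarPt, ← huy]
    show i (collarRadius 0 • u) = i ((2⁻¹ : ℝ) • u)
    norm_num [collarRadius]

end Double

/-! ### §2 The double of a homology sphere bounds a contractible manifold; Prop. B from Thm. 9.1 -/

section HomologySphere

variable {m : ℕ} {M : Type} [TopologicalSpace M] [T2Space M] [SecondCountableTopology M]
  [CompactSpace M] [ChartedSpace (𝔼 (m + 1)) M] [IsManifold (𝓡 (m + 1)) ∞ M]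

omit [IsManifold (𝓡 (m + 1)) ∞ M] in
/-- **A punctured closed simply connected homology sphere is contractible** (`m + 1 ≥ 3`): it is
simply connected (general position) and acyclic (Mayer–Vietoris), hence contractible by the
Whitehead–Hurewicz recognition theorem for manifolds, a THEOREM of the tree
(`Manifold.contractibleSpace_of_simplyConnected_of_acyclic_holds`). This is the input "`M ∖ {pt}`
is contractible" of Kervaire–Milnor's proof of Lemma 2.4 ("and therefore is contractible").
[cite: KervaireMilnorAnnals1963, Lemma 2.4, proof (p. 507)] -/
theorem contractibleSpace_compl_singleton [SimplyConnectedSpace M] (hm : 2 ≤ m)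
    (hH : ∀ k : ℕ, 0 < k → k ≠ m + 1 → IsZero (singularHomology ℤ ℤ M k))
    (hT : Nonempty (singularHomology ℤ ℤ M (m + 1) ≅ ModuleCat.of ℤ (ULift.{0} ℤ))) (p : M) :
    ContractibleSpace ↥(({p}ᶜ : Set M)) := by
  have hM : ∀ j : ℕ, j ≠ 0 → j ≠ m + 1 → IsZero (singularHomology ℤ ℤ M j) :=
    fun j hj0 hj => hH j (Nat.pos_of_ne_zero hj0) hj
  have hMtop : ¬ IsZero (singularHomology ℤ ℤ M (m + 1)) := by
    obtain ⟨e⟩ := hT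
    intro hz
    have hz' : IsZero (ModuleCat.of ℤ (ULift.{0} ℤ)) := hz.of_iso e.symm
    haveI := ModuleCat.subsingleton_of_isZero hz'
    exact absurd (Subsingleton.elim (ULift.up (1 : ℤ) : ULift.{0} ℤ) (ULift.up 0)) (by simp)
  haveI : SimplyConnectedSpace ↥(({p}ᶜ : Set M)) :=
    simplyConnectedSpace_compl_singleton (n := m + 1) (by omega) p
  have hac : ∀ k : ℕ, 1 ≤ k → IsZero (singularHomology ℤ ℤ ↥(({p}ᶜ : Set M)) k) :=
    fun k hk => isZero_singularHomology_compl_singleton_of_isZero (m := m) (by omega) hM hMtop p hk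
  exact Literature.AlgebraicTopology.Homotopy.Manifold.contractibleSpace_of_simplyConnected_of_acyclic_holds.of_isOpen
    (m + 1) isOpen_compl_singleton hac

/-- **Kervaire–Milnor's Lemma 2.4 for homology spheres: the double `M # (-M)` bounds a
contractible manifold.** For a closed simply connected smooth homology `(m+1)`-sphere `M : Type`,
`m + 1 ≥ 3`, and rotation data `R` (a disc `i`), the double `P₀` formed with `i` on both sides
bounds the rotation body `W` (`RotationData.nullCobordism`), and `W ≃ₕ M ∖ {i 0}`
(`RotationData.homotopyEquivPunct`) is contractible (`contractibleSpace_compl_singleton`).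
[cite: KervaireMilnorAnnals1963, Lemma 2.4 and its proof (p. 507)] -/
theorem boundsContractible_double [SimplyConnectedSpace M] (hm : 2 ≤ m)
    (hH : ∀ k : ℕ, 0 < k → k ≠ m + 1 → IsZero (singularHomology ℤ ℤ M k))
    (hT : Nonempty (singularHomology ℤ ℤ M (m + 1) ≅ ModuleCat.of ℤ (ULift.{0} ℤ)))
    (R : RotationData m M) :
    @BoundsContractible (m + 1) R.P₀ _ _ := by
  haveI : ContractibleSpace ↥R.Mpunct := by
    show ContractibleSpace ↥(({R.i 0}ᶜ : Set M))
    exact contractibleSpace_compl_singleton hm hH hT (R.i 0)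
  haveI : ContractibleSpace R.W := R.homotopyEquivPunct.contractibleSpace
  exact ⟨R.nullCobordism, inferInstanceAs (ContractibleSpace R.W)⟩

/-- **Prop. B from the h-cobordism theorem alone** (universe `0`, `n = m + 1 ≥ 5`): a closed
simply connected smooth homology `n`-sphere `M : Type` is homeomorphic to `Sⁿ`, GIVEN only Milnor's
Thm. 9.1 (`isTrivial_of_isHCobordism_of_five_le.{0}`). The double `P₀ = M # (-M)` is simply
connected (Seifert–van Kampen, `IsConnectedSum.simplyConnectedSpace_holds`) and bounds a
contractible manifold (`boundsContractible_double`), so it is homeomorphic to `Sⁿ` by the tree's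
route through Prop. A (`nonempty_homeomorph_sphere_of_boundsContractible`, with the homotopy half of
Lemma 2.3 now the theorem `NullCobordism.isHomotopyEquiv_compl_ball_of_contractibleSpace_holds`); then
Brown's Schoenflies theorem and the Alexander trick (`nonempty_homeomorph_sphere_of_double`, applied
in the round sphere to `e ∘ inl`, `e ∘ inr` for `e : P₀ ≅ Sⁿ`) give `M ≅ Sⁿ`. For `n = 5` this
replaces the Kervaire–Milnor–Wall theorem quoted by Milnor (p. 111).
[cite: MilnorHCobordism1965, §9, Prop. B and its proof (pp. 109–111)] [cite: KervaireMilnorAnnals1963, Lemma 2.4 (p. 507)] [cite: Daverman1986, Thm. II.6.6 (PDF p. 40)] -/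
theorem nonempty_homeomorph_sphere_of_homologySphere_of_double
    (h91 : isTrivial_of_isHCobordism_of_five_le.{0}) (hm : 4 ≤ m) [SimplyConnectedSpace M]
    (hH : ∀ k : ℕ, 0 < k → k ≠ m + 1 → IsZero (singularHomology ℤ ℤ M k))
    (hT : Nonempty (singularHomology ℤ ℤ M (m + 1) ≅ ModuleCat.of ℤ (ULift.{0} ℤ))) :
    Nonempty (M ≃ₜ 𝕊 (m + 1)) := by
  obtain ⟨R⟩ := nonempty_rotationData (m := m) (M := M)
  haveI := R.csd.t2Space_glued RotationData.hn
  haveI := R.csd.compactSpace_glued RotationData.hn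
  haveI := R.csd.secondCountableTopology_glued RotationData.hn
  haveI : SimplyConnectedSpace R.P₀ :=
    IsConnectedSum.simplyConnectedSpace_holds (by rw [finrank_euclideanSpace_fin]; omega)
      (ConnectedSumData.isConnectedSum_glued R.csd RotationData.hn)
  have hB : BoundsContractible (m + 1) R.P₀ := boundsContractible_double (by omega) hH hT R
  obtain ⟨e⟩ := nonempty_homeomorph_sphere_of_boundsContractible h91
    NullCobordism.isHomotopyEquiv_compl_ball_of_contractibleSpace_holds (by omega) hB
  -- Brown's theorem in the round sphere, for the two copies `e ∘ inl`, `e ∘ inr`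
  haveI : Fact (Module.finrank ℝ (𝔼 (m + 1 + 1)) = m + 1 + 1) := ⟨by simp⟩
  refine nonempty_homeomorph_sphere_of_double (by omega) R.isOpenEmbedding_i
    (isTopSphere_sphere (E := 𝔼 (m + 1 + 1))) (jA := e ∘ R.inlP) (jB := e ∘ R.inrP)
    (e.continuous.comp (R.csd.glueData RotationData.hn).continuous_inl)
    (e.injective.comp (R.csd.glueData RotationData.hn).inl_injective)
    (e.continuous.comp (R.csd.glueData RotationData.hn).continuous_inr) (fun x => ?_) (fun a b => ?_)
  · rcases (R.csd.glueData RotationData.hn).exists_inl_or_inr (e.symm x) with ⟨a, ha⟩ | ⟨b, hb⟩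
    · exact Or.inl ⟨a, (congrArg e ha).trans (e.apply_symm_apply x)⟩
    · exact Or.inr ⟨b, (congrArg e hb).trans (e.apply_symm_apply x)⟩
  · show e (R.inlP a) = e (R.inrP b) ↔ _
    rw [e.injective.eq_iff]
    exact ((R.csd.glueData RotationData.hn).inl_eq_inr_iff).trans
      (R.csd.connectedSumRel_iff_φ RotationData.hn a b).symm

end HomologySphere

end SmaleHomologySpheres

/-! ### §3 The named fact from Thm. 9.1 alone, every universe -/

/-- **Milnor's Prop. B (`nonempty_homeomorph_sphere_of_homologySphere_of_five_le`) at every universe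
from the h-cobordism theorem ALONE.** GIVEN Milnor's Thm. 9.1 at universe `0`
(`isTrivial_of_isHCobordism_of_five_le.{0}`, the one remaining hub), every closed simply connected
smooth homology `n`-sphere, `n ≥ 5`, is homeomorphic to `Sⁿ`: at universe `0` by the double route
(`SmaleHomologySpheres.nonempty_homeomorph_sphere_of_homologySphere_of_double`: Kervaire–Milnor's
Lemma 2.4, Prop. A via Thm. 9.1 and Lemma 2.3, Brown's Schoenflies theorem, the Alexander trick),
and at universe `u` by transport to a small copy
(`nonempty_homeomorph_sphere_of_homologySphere_of_five_le_of_univ_zero`). Compared with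
`nonempty_homeomorph_sphere_of_homologySphere_of_five_le_of_three_hubs` the Kervaire–Milnor–Wall
hub (`Θ₅ = 0`) is gone and Lemma 2.3 is fed by its discharge. The unconditional `…_holds` is this
theorem applied to `isTrivial_of_isHCobordism_of_five_le_holds` when that lands.
[cite: MilnorHCobordism1965, §9, Prop. B (p. 109) and Thm. 9.1 (p. 107)] -/
theorem nonempty_homeomorph_sphere_of_homologySphere_of_five_le_of_hcobordism_theorem
    (h91 : isTrivial_of_isHCobordism_of_five_le.{0}) :
    nonempty_homeomorph_sphere_of_homologySphere_of_five_le.{u} := by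
  apply nonempty_homeomorph_sphere_of_homologySphere_of_five_le_of_univ_zero
  intro n hn M _ _ _ _ _ _ _ hH hT
  obtain ⟨m, rfl⟩ : ∃ m, n = m + 1 := ⟨n - 1, by omega⟩
  exact SmaleHomologySpheres.nonempty_homeomorph_sphere_of_homologySphere_of_double h91 (by omega) hH hT

end Literature.Topology.FourManifolds

end
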